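import Literature.Analysis.PDE.CoordWordTame
import HarnessLib

/-!
# The energy inequality at every Sobolev order for first-order symmetric (hyperbolic) operators
# with smooth bounded coefficients on `ℝⁿ` (topic `Analysis/PDE`)

Analytic layer of the energy-method existence theory for **linear first-order symmetric
hyperbolic systems** `∂ₜU = Σⱼ Aⱼ(t, x) ∂ⱼU + B(t, x) U` on `ℝ × ℝⁿ` (Friedrichs 1954), built to
discharge the named fact `Literature.Geometry.Lorentzian.KerrSchild.waveCauchyProblem` (the
Cauchy problem for divergence-form wave operators of generalised Kerr–Schild metrics on `ℝ⁴`,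
reduced to first-order symmetric form). This file is purely spatial (the time is frozen) and
proves the one estimate from which both the a-priori bounds of the regularised problems and the
convergence of the regularisation are derived: for the operator

  `𝒫U (x) = Σⱼ Aⱼ(x) (∂ⱼU)(x) + B(x) U(x)`,   `∂ⱼ = ∂/∂xⱼ` along the standard frame,

with `Aⱼ(x), B(x) ∈ End(W)` smooth, **`Aⱼ(x)` symmetric** for the inner product of the
finite-dimensional real inner product space `W`, and all coordinate derivatives of the
coefficients up to the relevant order bounded by `M`, and for every smooth `U : ℝⁿ → W` whose
coordinate word derivatives of length `≤ k + 1` are square integrable,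

* `abs_integral_inner_cwd_foOp_le` — for every word `v` of length `≤ k`,
  `|∫ ⟪∂_v U, ∂_v (𝒫U)⟫| ≤ (n + 1) 2ᵏ M · ℰ_k(U)`, where `ℰ_k(U) = Σ_{|u| ≤ k} ‖∂_u U‖²_{L²}`
  (`wordEnergy`);
* `abs_sum_integral_inner_cwd_foOp_le` — summed over the words of length `≤ k`:
  `|Σ_{|v| ≤ k} ∫ ⟪∂_v U, ∂_v (𝒫U)⟫| ≤ N_k (n + 1) 2ᵏ M · ℰ_k(U)`, `N_k` the number of such words.

This is the classical computation (Friedrichs 1954, §§1–2; Lax 2006, Ch. 6; Taylor, *PDE I*, Ch. 6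
§5 / *PDE III*, Ch. 16 §1; Evans, *PDE*, §7.3.2, Thm. 2 for the corresponding Galerkin estimate):
`∂_v (Aⱼ ∂ⱼU) = Aⱼ ∂ⱼ ∂_v U + [∂_v, Aⱼ] ∂ⱼ U`, the commutator carrying at most `|v|` derivatives on
`U` (Leibniz over the splittings of `v`, `cwd_bilinear`), and at top order the symmetry of `Aⱼ`
with one integration by parts gives `2 ∫ ⟪∂_v U, Aⱼ ∂ⱼ ∂_v U⟫ = −∫ ⟪∂_v U, (∂ⱼAⱼ) ∂_v U⟫`
(`abs_integral_inner_clm_fderiv_le`). No compact support is assumed (the functions met in the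
regularisation are mollified `L²` fields): the integration by parts is Mathlib's
`integral_bilinear_fderiv_right_eq_neg_left_of_integrable`.

For a solution, `d/dt ℰ_k(U(t)) = 2 Σ_{|v| ≤ k} ∫ ⟪∂_v U, ∂_v (𝒫U)⟫`, so the second estimate is
Grönwall's differential inequality `ℰ_k' ≤ C ℰ_k`; the same estimate applied to differences
controls the convergence of Friedrichs' regularisation `∂ₜU = J_ε 𝒫 J_ε U`.

Everything is proved; no named fact and no `sorry` is introduced.

## References

* K. O. Friedrichs, *Symmetric hyperbolic linear differential equations*, Comm. Pure Appl. Math.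
  7 (1954) 345–392, §§1–2 (the energy inequality). [Friedrichs1954]
* P. D. Lax, *Hyperbolic Partial Differential Equations*, Courant Lecture Notes 14, AMS 2006,
  Ch. 6 (energy inequalities for symmetric hyperbolic systems). [Lax2006]
* L. C. Evans, *Partial Differential Equations*, 2nd ed., AMS 2010, §7.3.2 (symmetric hyperbolic
  systems; Thm. 2, energy estimates) and App. C.2 (Leibniz). [Evans2010]
-/

noncomputable section

open MeasureTheory Set Function Filter
open scoped ContDiff Topology RealInnerProductSpace ENNReal NNReal

namespace Literature.Analysis.PDE

open Literature.Analysis.FunctionSpaces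

variable {ι : Type*} [Fintype ι] [DecidableEq ι]

/-! ### Words of bounded length -/

variable (ι) in
/-- The finite set of words of length `≤ k` in the alphabet `ι` (the multi-indices, with order, of
the derivatives entering the sum-form `H^k` norm). [folklore] -/
def wordsLE (k : ℕ) : Finset (List ι) :=
  (Finset.range (k + 1)).biUnion fun j ↦
    (Finset.univ : Finset (List.Vector ι j)).image fun v ↦ v.toList

/-- Membership in `wordsLE ι k` is `length ≤ k`. [folklore] -/
theorem mem_wordsLE {k : ℕ} {v : List ι} : v ∈ wordsLE ι k ↔ v.length ≤ k := by
  constructor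
  · intro h
    simp only [wordsLE, Finset.mem_biUnion, Finset.mem_range, Finset.mem_image,
      Finset.mem_univ, true_and] at h
    obtain ⟨j, hj, w, rfl⟩ := h
    rw [List.Vector.toList_length]
    omega
  · intro h
    simp only [wordsLE, Finset.mem_biUnion, Finset.mem_range, Finset.mem_image,
      Finset.mem_univ, true_and]
    exact ⟨v.length, by omega, ⟨v, rfl⟩, rfl⟩

/-- The empty word belongs to every `wordsLE ι k`. [folklore] -/
theorem nil_mem_wordsLE (k : ℕ) : ([] : List ι) ∈ wordsLE ι k :=
  mem_wordsLE.2 (by simp)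

/-- `wordsLE` is monotone in the length bound. [folklore] -/
theorem wordsLE_mono {k l : ℕ} (h : k ≤ l) : wordsLE ι k ⊆ wordsLE ι l :=
  fun _ hv ↦ mem_wordsLE.2 ((mem_wordsLE.1 hv).trans h)

/-! ### The real `L²` norm and the word energy -/

section L2

variable {F : Type*} [NormedAddCommGroup F]

/-- The `L²(ℝⁿ)` norm as a real number, `‖f‖₂ = (eLpNorm f 2 volume).toReal` (junk value `0` when
infinite, which never happens under the `MemLp` hypotheses below). [folklore] -/
def l2norm (f : EuclideanSpace ℝ ι → F) : ℝ :=
  (eLpNorm f 2 (volume : Measure (EuclideanSpace ℝ ι))).toReal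

omit [DecidableEq ι] in
/-- Unfolding of `l2norm`. [folklore] -/
theorem l2norm_def (f : EuclideanSpace ℝ ι → F) :
    l2norm f = (eLpNorm f 2 (volume : Measure (EuclideanSpace ℝ ι))).toReal := rfl

omit [DecidableEq ι] in
/-- `0 ≤ ‖f‖₂`. [folklore] -/
theorem l2norm_nonneg (f : EuclideanSpace ℝ ι → F) : 0 ≤ l2norm f := ENNReal.toReal_nonneg

omit [DecidableEq ι] in
/-- For `f ∈ L²`, `eLpNorm f 2 = ofReal ‖f‖₂`. [folklore] -/
theorem eLpNorm_eq_ofReal_l2norm {f : EuclideanSpace ℝ ι → F}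
    (hf : MemLp f 2 (volume : Measure (EuclideanSpace ℝ ι))) :
    eLpNorm f 2 (volume : Measure (EuclideanSpace ℝ ι)) = ENNReal.ofReal (l2norm f) := by
  rw [l2norm_def, ENNReal.ofReal_toReal hf.eLpNorm_ne_top]

omit [DecidableEq ι] in
/-- **Pointwise domination in `L²`**: if `‖f‖ ≤ c ‖g‖` pointwise with `g ∈ L²`, `f` continuous and
`0 ≤ c`, then `f ∈ L²` and `‖f‖₂ ≤ c ‖g‖₂`. [folklore] -/
theorem memLp_and_l2norm_le_of_le {G : Type*} [NormedAddCommGroup G]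
    {f : EuclideanSpace ℝ ι → F} {g : EuclideanSpace ℝ ι → G} (hf : Continuous f)
    (hg : MemLp g 2 (volume : Measure (EuclideanSpace ℝ ι))) {c : ℝ} (hc : 0 ≤ c)
    (h : ∀ x, ‖f x‖ ≤ c * ‖g x‖) :
    MemLp f 2 (volume : Measure (EuclideanSpace ℝ ι)) ∧ l2norm f ≤ c * l2norm g := by
  have hmem : MemLp f 2 (volume : Measure (EuclideanSpace ℝ ι)) :=
    hg.of_le_mul hf.aestronglyMeasurable (Eventually.of_forall h)
  refine ⟨hmem, ?_⟩
  have hle := eLpNorm_le_mul_eLpNorm_of_ae_le_mul (μ := (volume : Measure (EuclideanSpace ℝ ι)))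
    (Eventually.of_forall h) 2
  rw [l2norm_def, l2norm_def]
  calc (eLpNorm f 2 volume).toReal
      ≤ (ENNReal.ofReal c * eLpNorm g 2 volume).toReal :=
        ENNReal.toReal_mono (ENNReal.mul_ne_top ENNReal.ofReal_ne_top hg.eLpNorm_ne_top) hle
    _ = c * (eLpNorm g 2 volume).toReal := by rw [ENNReal.toReal_mul, ENNReal.toReal_ofReal hc]

omit [DecidableEq ι] in
/-- Triangle inequality for `‖·‖₂` on `L²`. [folklore] -/
theorem l2norm_add_le {F : Type*} [NormedAddCommGroup F] {f g : EuclideanSpace ℝ ι → F}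
    (hf : MemLp f 2 (volume : Measure (EuclideanSpace ℝ ι)))
    (hg : MemLp g 2 (volume : Measure (EuclideanSpace ℝ ι))) :
    l2norm (f + g) ≤ l2norm f + l2norm g := by
  rw [l2norm_def, l2norm_def, l2norm_def, ← ENNReal.toReal_add hf.eLpNorm_ne_top hg.eLpNorm_ne_top]
  exact ENNReal.toReal_mono (ENNReal.add_ne_top.2 ⟨hf.eLpNorm_ne_top, hg.eLpNorm_ne_top⟩)
    (eLpNorm_add_le hf.aestronglyMeasurable hg.aestronglyMeasurable one_le_two)

omit [DecidableEq ι] in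
/-- **`L²` bound for a list sum**: if every term of a list of `L²` functions has `‖·‖₂ ≤ b`, the
pointwise sum is in `L²` with `‖·‖₂ ≤ (length) · b`. [folklore] -/
theorem memLp_list_sum_and_l2norm_le {F : Type*} [NormedAddCommGroup F] {κ : Type*}
    (l : List κ) {g : κ → EuclideanSpace ℝ ι → F}
    (hg : ∀ p ∈ l, MemLp (g p) 2 (volume : Measure (EuclideanSpace ℝ ι))) {b : ℝ}
    (hb : ∀ p ∈ l, l2norm (g p) ≤ b) :
    MemLp (fun x ↦ (l.map fun p ↦ g p x).sum) 2 (volume : Measure (EuclideanSpace ℝ ι)) ∧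
      l2norm (fun x ↦ (l.map fun p ↦ g p x).sum) ≤ l.length * b := by
  induction l with
  | nil =>
    refine ⟨?_, ?_⟩
    · simp
    · simp [l2norm_def]
  | cons p l ih =>
    have hgp : MemLp (g p) 2 volume := hg p List.mem_cons_self
    have hl : ∀ q ∈ l, MemLp (g q) 2 volume := fun q hq ↦ hg q (List.mem_cons_of_mem _ hq)
    have hbl : ∀ q ∈ l, l2norm (g q) ≤ b := fun q hq ↦ hb q (List.mem_cons_of_mem _ hq)
    obtain ⟨hmem, hle⟩ := ih hl hbl
    have heq : (fun x ↦ ((p :: l).map fun q ↦ g q x).sum) =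
        g p + fun x ↦ (l.map fun q ↦ g q x).sum := by
      funext x; simp
    rw [heq]
    refine ⟨hgp.add hmem, ?_⟩
    calc l2norm (g p + fun x ↦ (l.map fun q ↦ g q x).sum)
        ≤ l2norm (g p) + l2norm (fun x ↦ (l.map fun q ↦ g q x).sum) := l2norm_add_le hgp hmem
      _ ≤ b + l.length * b := add_le_add (hb p List.mem_cons_self) hle
      _ = ((p :: l).length : ℝ) * b := by simp; ring

omit [DecidableEq ι] in
/-- **`L²` bound for a finite sum**: if every term has `‖·‖₂ ≤ b`, the sum is in `L²` with
`‖·‖₂ ≤ (card) · b`. [folklore] -/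
theorem memLp_finset_sum_and_l2norm_le {F : Type*} [NormedAddCommGroup F] {κ : Type*}
    (s : Finset κ) {g : κ → EuclideanSpace ℝ ι → F}
    (hg : ∀ p ∈ s, MemLp (g p) 2 (volume : Measure (EuclideanSpace ℝ ι))) {b : ℝ}
    (hb : ∀ p ∈ s, l2norm (g p) ≤ b) :
    MemLp (fun x ↦ ∑ p ∈ s, g p x) 2 (volume : Measure (EuclideanSpace ℝ ι)) ∧
      l2norm (fun x ↦ ∑ p ∈ s, g p x) ≤ s.card * b := by
  classical
  induction s using Finset.induction_on with
  | empty =>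
    refine ⟨?_, ?_⟩
    · simp
    · simp [l2norm_def]
  | insert p s hps ih =>
    have hgp : MemLp (g p) 2 volume := hg p (Finset.mem_insert_self _ _)
    have hs : ∀ q ∈ s, MemLp (g q) 2 volume := fun q hq ↦ hg q (Finset.mem_insert_of_mem hq)
    have hbs : ∀ q ∈ s, l2norm (g q) ≤ b := fun q hq ↦ hb q (Finset.mem_insert_of_mem hq)
    obtain ⟨hmem, hle⟩ := ih hs hbs
    have heq : (fun x ↦ ∑ q ∈ insert p s, g q x) = g p + fun x ↦ ∑ q ∈ s, g q x := by
      funext x; simp [Finset.sum_insert hps]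
    rw [heq]
    refine ⟨hgp.add hmem, ?_⟩
    calc l2norm (g p + fun x ↦ ∑ q ∈ s, g q x)
        ≤ l2norm (g p) + l2norm (fun x ↦ ∑ q ∈ s, g q x) := l2norm_add_le hgp hmem
      _ ≤ b + s.card * b := add_le_add (hb p (Finset.mem_insert_self _ _)) hle
      _ = ((insert p s).card : ℝ) * b := by rw [Finset.card_insert_of_notMem hps]; push_cast; ring

end L2

section Energy

variable {W : Type*} [NormedAddCommGroup W] [InnerProductSpace ℝ W]

/-- **The word energy of order `k`**: `ℰ_k(U) = Σ_{|v| ≤ k} ‖∂_v U‖₂²`, the squared sum-form `H^k`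
norm over ordered words in the standard frame (Adams, *Sobolev Spaces*, ¶3.1; with harmless
repetitions of the mixed derivatives). [folklore] -/
def wordEnergy (k : ℕ) (U : EuclideanSpace ℝ ι → W) : ℝ :=
  ∑ v ∈ wordsLE ι k, l2norm (cwd v U) ^ 2

/-- `0 ≤ ℰ_k(U)`. [folklore] -/
theorem wordEnergy_nonneg (k : ℕ) (U : EuclideanSpace ℝ ι → W) : 0 ≤ wordEnergy k U :=
  Finset.sum_nonneg fun _ _ ↦ sq_nonneg _

/-- Each term is bounded by the energy: `‖∂_v U‖₂² ≤ ℰ_k(U)` for `|v| ≤ k`. [folklore] -/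
theorem l2norm_cwd_sq_le_wordEnergy {k : ℕ} {v : List ι} (hv : v.length ≤ k)
    (U : EuclideanSpace ℝ ι → W) : l2norm (cwd v U) ^ 2 ≤ wordEnergy k U :=
  Finset.single_le_sum (f := fun v ↦ l2norm (cwd v U) ^ 2) (fun _ _ ↦ sq_nonneg _)
    (mem_wordsLE.2 hv)

/-- `‖∂_v U‖₂ ≤ ℰ_k(U)^{1/2}` for `|v| ≤ k`. [folklore] -/
theorem l2norm_cwd_le_sqrt_wordEnergy {k : ℕ} {v : List ι} (hv : v.length ≤ k)
    (U : EuclideanSpace ℝ ι → W) : l2norm (cwd v U) ≤ Real.sqrt (wordEnergy k U) := by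
  rw [← Real.sqrt_sq (l2norm_nonneg _)]
  exact Real.sqrt_le_sqrt (l2norm_cwd_sq_le_wordEnergy hv U)

/-- Monotonicity of the energy in the order. [folklore] -/
theorem wordEnergy_mono {k l : ℕ} (h : k ≤ l) (U : EuclideanSpace ℝ ι → W) :
    wordEnergy k U ≤ wordEnergy l U :=
  Finset.sum_le_sum_of_subset_of_nonneg (wordsLE_mono h) fun _ _ _ ↦ sq_nonneg _

/-! ### The regularity class: smooth fields with square-integrable word derivatives -/

/-- **`H^k`-smooth fields**: `U` is `C^∞` and its coordinate word derivatives of length `≤ k` are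
square integrable (the smooth, non-compactly-supported elements of `H^k(ℝⁿ; W)` — e.g. mollified
`L²` fields). [folklore] -/
structure IsHkSmooth (k : ℕ) (U : EuclideanSpace ℝ ι → W) : Prop where
  /-- Smoothness. -/
  smooth : ContDiff ℝ ∞ U
  /-- Square integrability of the word derivatives of length `≤ k`. -/
  memLp : ∀ v : List ι, v.length ≤ k → MemLp (cwd v U) 2 (volume : Measure (EuclideanSpace ℝ ι))

omit [DecidableEq ι] in
/-- `H^k`-smooth fields are `H^j`-smooth for `j ≤ k`. [folklore] -/
theorem IsHkSmooth.mono {k j : ℕ} {U : EuclideanSpace ℝ ι → W} (hU : IsHkSmooth k U)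
    (h : j ≤ k) : IsHkSmooth j U :=
  ⟨hU.smooth, fun v hv ↦ hU.memLp v (hv.trans h)⟩

omit [DecidableEq ι] in
/-- A word derivative of an `H^{k + |u|}`-smooth field is `H^k`-smooth. [folklore] -/
theorem IsHkSmooth.cwd_right {k : ℕ} {U : EuclideanSpace ℝ ι → W} (u : List ι)
    (hU : IsHkSmooth (k + u.length) U) : IsHkSmooth k (cwd u U) := by
  refine ⟨contDiff_cwd hU.smooth u, fun v hv ↦ ?_⟩
  rw [← cwd_append]
  exact hU.memLp (v ++ u) (by simp; omega)

/-! ### Coefficients: smooth, bounded with their derivatives, symmetric -/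

/-- **Admissible coefficients of a first-order symmetric operator at order `k`**: the matrices
`Aⱼ, B : ℝⁿ → End(W)` are smooth, `Aⱼ(x)` is symmetric for the inner product of `W`, and all word
derivatives of `Aⱼ` of length `≤ k + 1`, of `B` of length `≤ k`, are bounded by `M` in operator
norm (Friedrichs 1954, §1: symmetric coefficient matrices with bounded derivatives).
[cite: Friedrichs1954, §1] -/
structure IsSymmCoeff (k : ℕ) (M : ℝ) (A : ι → EuclideanSpace ℝ ι → (W →L[ℝ] W))
    (B : EuclideanSpace ℝ ι → (W →L[ℝ] W)) : Prop where
  /-- Smoothness of the `Aⱼ`. -/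
  smoothA : ∀ j, ContDiff ℝ ∞ (A j)
  /-- Smoothness of `B`. -/
  smoothB : ContDiff ℝ ∞ B
  /-- Symmetry of the `Aⱼ(x)`. -/
  symm : ∀ j x (u w : W), ⟪A j x u, w⟫ = ⟪u, A j x w⟫
  /-- Bounds for the word derivatives of the `Aⱼ` of length `≤ k + 1`. -/
  boundA : ∀ j (v : List ι), v.length ≤ k + 1 → ∀ x, ‖cwd v (A j) x‖ ≤ M
  /-- Bounds for the word derivatives of `B` of length `≤ k`. -/
  boundB : ∀ v : List ι, v.length ≤ k → ∀ x, ‖cwd v B x‖ ≤ M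

omit [DecidableEq ι] in
/-- The bound `M` of admissible coefficients is nonnegative (it bounds `‖B x‖`). [folklore] -/
theorem IsSymmCoeff.nonneg {k : ℕ} {M : ℝ} {A : ι → EuclideanSpace ℝ ι → (W →L[ℝ] W)}
    {B : EuclideanSpace ℝ ι → (W →L[ℝ] W)} (h : IsSymmCoeff k M A B) : 0 ≤ M :=
  (norm_nonneg _).trans (h.boundB [] (by simp) 0)

omit [DecidableEq ι] in
/-- Admissible coefficients at order `k` are admissible at every order `j ≤ k`. [folklore] -/
theorem IsSymmCoeff.mono {k j : ℕ} {M : ℝ} {A : ι → EuclideanSpace ℝ ι → (W →L[ℝ] W)}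
    {B : EuclideanSpace ℝ ι → (W →L[ℝ] W)} (h : IsSymmCoeff k M A B) (hjk : j ≤ k) :
    IsSymmCoeff j M A B :=
  ⟨h.smoothA, h.smoothB, h.symm, fun i v hv x ↦ h.boundA i v (by omega) x,
    fun v hv x ↦ h.boundB v (hv.trans hjk) x⟩

/-! ### The operator -/

/-- **The first-order operator** `𝒫U (x) = Σⱼ Aⱼ(x) (∂ⱼU)(x) + B(x) U(x)` with `∂ⱼ` the derivative
along the standard frame vector `bv j`. [cite: Friedrichs1954, §1] -/
def foOp (A : ι → EuclideanSpace ℝ ι → (W →L[ℝ] W)) (B : EuclideanSpace ℝ ι → (W →L[ℝ] W))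
    (U : EuclideanSpace ℝ ι → W) : EuclideanSpace ℝ ι → W :=
  fun x ↦ (∑ j, A j x (fderiv ℝ U x (bv j))) + B x (U x)

omit [DecidableEq ι] in
/-- Unfolding of `foOp`. [cite: Friedrichs1954, §1] -/
theorem foOp_apply (A : ι → EuclideanSpace ℝ ι → (W →L[ℝ] W))
    (B : EuclideanSpace ℝ ι → (W →L[ℝ] W)) (U : EuclideanSpace ℝ ι → W) (x : EuclideanSpace ℝ ι) :
    foOp A B U x = (∑ j, A j x (fderiv ℝ U x (bv j))) + B x (U x) := rfl

end Energy

section Estimates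

variable {W : Type*} [NormedAddCommGroup W] [InnerProductSpace ℝ W]

/-! ### `L²` pairings -/

omit [DecidableEq ι] in
/-- The pairing `x ↦ ⟪f x, g x⟫` of two `L²` fields is integrable. [folklore] -/
theorem integrable_inner_of_memLp {f g : EuclideanSpace ℝ ι → W}
    (hf : MemLp f 2 (volume : Measure (EuclideanSpace ℝ ι)))
    (hg : MemLp g 2 (volume : Measure (EuclideanSpace ℝ ι))) :
    Integrable (fun x ↦ ⟪f x, g x⟫) (volume : Measure (EuclideanSpace ℝ ι)) := by
  have h := L2.integrable_inner (𝕜 := ℝ) (hf.toLp f) (hg.toLp g)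
  refine h.congr ?_
  filter_upwards [hf.coeFn_toLp, hg.coeFn_toLp] with x hfx hgx
  rw [hfx, hgx]

omit [DecidableEq ι] in
/-- Cauchy–Schwarz in the `l2norm` currency: `|∫ ⟪f, g⟫| ≤ ‖f‖₂ ‖g‖₂`. [folklore] -/
theorem abs_integral_inner_le_l2norm {f g : EuclideanSpace ℝ ι → W}
    (hf : MemLp f 2 (volume : Measure (EuclideanSpace ℝ ι)))
    (hg : MemLp g 2 (volume : Measure (EuclideanSpace ℝ ι))) :
    |∫ x, ⟪f x, g x⟫| ≤ l2norm f * l2norm g :=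
  abs_integral_inner_le_of_memLp hf hg

omit [DecidableEq ι] in
/-- **A bounded operator field applied to an `L²` field**: if `‖C x‖ ≤ M` and `g ∈ L²` then
`x ↦ C(x) g(x)` is in `L²` with `‖C g‖₂ ≤ M ‖g‖₂` (continuity for measurability). [folklore] -/
theorem memLp_clm_apply_and_l2norm_le {V : Type*} [NormedAddCommGroup V] [NormedSpace ℝ V]
    {C : EuclideanSpace ℝ ι → (V →L[ℝ] W)} {g : EuclideanSpace ℝ ι → V} (hC : Continuous C)
    (hg : Continuous g) (hg2 : MemLp g 2 (volume : Measure (EuclideanSpace ℝ ι))) {M : ℝ}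
    (hM0 : 0 ≤ M) (hM : ∀ x, ‖C x‖ ≤ M) :
    MemLp (fun x ↦ C x (g x)) 2 (volume : Measure (EuclideanSpace ℝ ι)) ∧
      l2norm (fun x ↦ C x (g x)) ≤ M * l2norm g :=
  memLp_and_l2norm_le_of_le (hC.clm_apply hg) hg2 hM0 fun x ↦
    ((C x).le_opNorm (g x)).trans (mul_le_mul_of_nonneg_right (hM x) (norm_nonneg _))

/-! ### The top-order term: symmetry and one integration by parts -/

omit [DecidableEq ι] in
/-- **The symmetric top-order term.** For a `C¹` symmetric operator field `A` with `‖A‖ ≤ M`,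
`‖∂ⱼA‖ ≤ M`, and a `C¹` field `f` with `f, ∂ⱼf ∈ L²`:
`|∫ ⟪f, A ∂ⱼ f⟫| ≤ (M/2) ‖f‖₂²` — since `2 ∫ ⟪A f, ∂ⱼ f⟫ = −∫ ⟪(∂ⱼA) f, f⟫` by the symmetry of
`A` and an integration by parts without boundary terms (Friedrichs 1954, §2; Evans, *PDE*,
§7.3.2). [cite: Friedrichs1954, §2] -/
theorem abs_integral_inner_clm_fderiv_le {A : EuclideanSpace ℝ ι → (W →L[ℝ] W)}
    {f : EuclideanSpace ℝ ι → W} (hA : ContDiff ℝ 1 A)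
    (hsym : ∀ x (u w : W), ⟪A x u, w⟫ = ⟪u, A x w⟫) {M : ℝ} (hM0 : ∀ x, ‖A x‖ ≤ M) (j : ι)
    (hM1 : ∀ x, ‖fderiv ℝ A x (bv j)‖ ≤ M) (hf : ContDiff ℝ 1 f)
    (hf2 : MemLp f 2 (volume : Measure (EuclideanSpace ℝ ι)))
    (hfj : MemLp (fun x ↦ fderiv ℝ f x (bv j)) 2 (volume : Measure (EuclideanSpace ℝ ι))) :
    |∫ x, ⟪f x, A x (fderiv ℝ f x (bv j))⟫| ≤ M / 2 * l2norm f ^ 2 := by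
  have hM : 0 ≤ M := (norm_nonneg _).trans (hM0 0)
  have hAc : Continuous A := hA.continuous
  have hfc : Continuous f := hf.continuous
  have hfjc : Continuous fun x ↦ fderiv ℝ f x (bv j) :=
    (hf.continuous_fderiv one_ne_zero).clm_apply continuous_const
  have hAjc : Continuous fun x ↦ fderiv ℝ A x (bv j) :=
    (hA.continuous_fderiv one_ne_zero).clm_apply continuous_const
  -- `g = A f`
  set g : EuclideanSpace ℝ ι → W := fun x ↦ A x (f x) with hgdef
  obtain ⟨hg2, -⟩ := memLp_clm_apply_and_l2norm_le hAc hfc hf2 hM hM0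
  have hdiffg : ∀ x, DifferentiableAt ℝ g x := fun x ↦
    ((hA.differentiable one_ne_zero x).clm_apply (hf.differentiable one_ne_zero x))
  have hdg : ∀ x, fderiv ℝ g x (bv j) = fderiv ℝ A x (bv j) (f x) + A x (fderiv ℝ f x (bv j)) := by
    intro x
    rw [hgdef, fderiv_clm_apply (hA.differentiable one_ne_zero x) (hf.differentiable one_ne_zero x)]
    simp only [add_apply, ContinuousLinearMap.coe_comp, comp_apply,
      ContinuousLinearMap.flip_apply]
    rw [add_comm]
  -- the two pieces of `∂ⱼ g` are in `L²`
  obtain ⟨hP1, hP1le⟩ := memLp_clm_apply_and_l2norm_le hAjc hfc hf2 hM hM1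
  obtain ⟨hP2, -⟩ := memLp_clm_apply_and_l2norm_le hAc hfjc hfj hM hM0
  have hdg2 : MemLp (fun x ↦ fderiv ℝ g x (bv j)) 2 (volume : Measure (EuclideanSpace ℝ ι)) := by
    have : (fun x ↦ fderiv ℝ g x (bv j)) =
        (fun x ↦ fderiv ℝ A x (bv j) (f x)) + fun x ↦ A x (fderiv ℝ f x (bv j)) := by
      funext x; exact hdg x
    rw [this]
    exact hP1.add hP2
  -- integration by parts: `∫ ⟪g, ∂ⱼ f⟫ = -∫ ⟪∂ⱼ g, f⟫`
  have key := integral_bilinear_fderiv_right_eq_neg_left_of_integrable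
    (μ := (volume : Measure (EuclideanSpace ℝ ι))) (B := ipCLM W) (f := g) (g := f) (v := bv j)
    (by simpa only [ipCLM_apply] using integrable_inner_of_memLp hdg2 hf2)
    (by simpa only [ipCLM_apply] using integrable_inner_of_memLp hg2 hfj)
    (by simpa only [ipCLM_apply] using integrable_inner_of_memLp hg2 hf2)
    (fun x _ ↦ hdiffg x) (fun x _ ↦ hf.differentiable one_ne_zero x)
  simp only [ipCLM_apply] at key
  -- rewrite the target and `∫ ⟪∂ⱼ g, f⟫` through the symmetry of `A`
  have hT : (∫ x, ⟪f x, A x (fderiv ℝ f x (bv j))⟫) = ∫ x, ⟪g x, fderiv ℝ f x (bv j)⟫ := by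
    refine integral_congr_ae (Eventually.of_forall fun x ↦ ?_)
    change ⟪f x, A x (fderiv ℝ f x (bv j))⟫ = ⟪A x (f x), fderiv ℝ f x (bv j)⟫
    rw [hsym x (f x)]
  have hsplit : (∫ x, ⟪fderiv ℝ g x (bv j), f x⟫) =
      (∫ x, ⟪fderiv ℝ A x (bv j) (f x), f x⟫) + ∫ x, ⟪g x, fderiv ℝ f x (bv j)⟫ := by
    have h1 : (fun x ↦ ⟪fderiv ℝ g x (bv j), f x⟫) =
        fun x ↦ ⟪fderiv ℝ A x (bv j) (f x), f x⟫ + ⟪g x, fderiv ℝ f x (bv j)⟫ := by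
      funext x
      rw [hdg x, inner_add_left]
      congr 1
      change ⟪A x (fderiv ℝ f x (bv j)), f x⟫ = ⟪A x (f x), fderiv ℝ f x (bv j)⟫
      rw [hsym x, real_inner_comm]
    rw [h1]
    exact integral_add (integrable_inner_of_memLp hP1 hf2) (integrable_inner_of_memLp hg2 hfj)
  -- hence `2 I = -J`
  have hI : (∫ x, ⟪g x, fderiv ℝ f x (bv j)⟫) =
      -(1 / 2) * ∫ x, ⟪fderiv ℝ A x (bv j) (f x), f x⟫ := by
    linarith [key, hsplit]
  rw [hT, hI, abs_mul, abs_neg, abs_of_pos (by norm_num : (0 : ℝ) < 1 / 2)]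
  have hJ := abs_integral_inner_le_l2norm hP1 hf2
  calc 1 / 2 * |∫ x, ⟪fderiv ℝ A x (bv j) (f x), f x⟫|
      ≤ 1 / 2 * (M * l2norm f * l2norm f) := by
        gcongr
        exact hJ.trans (mul_le_mul_of_nonneg_right hP1le (l2norm_nonneg _))
    _ = M / 2 * l2norm f ^ 2 := by ring

/-! ### Word derivatives of the operator -/

omit [DecidableEq ι] in
/-- `∂_v ∂ⱼ U = ∂ⱼ ∂_v U` for smooth `U` (Schwarz), in the `cwd` currency. [folklore] -/
theorem cwd_fderiv_eq_fderiv_cwd {U : EuclideanSpace ℝ ι → W} (hU : ContDiff ℝ ∞ U) (v : List ι)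
    (j : ι) : cwd v (fun y ↦ fderiv ℝ U y (bv j)) = fun x ↦ fderiv ℝ (cwd v U) x (bv j) := by
  rw [← cwd_cons_eq_cwd_fderiv hU j v, cwd_cons]

variable (W) in
/-- Application `(A, u) ↦ A u` as a continuous bilinear map `End(W) × W → W` (the identity of
`End(W)`, retyped for `cwd_bilinear`). [folklore] -/
def applyCLM : (W →L[ℝ] W) →L[ℝ] W →L[ℝ] W := ContinuousLinearMap.id ℝ (W →L[ℝ] W)

omit [Fintype ι] [DecidableEq ι] in
/-- `applyCLM W A u = A u`. [folklore] -/
@[simp]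
theorem applyCLM_apply (A : W →L[ℝ] W) (u : W) : applyCLM W A u = A u := rfl

omit [DecidableEq ι] in
/-- **Leibniz expansion of `∂_v (C g)`** for a smooth operator field `C` and a smooth field `g`,
with the zeroth-order term split off: `∂_v (C g) = C ∂_v g + Σ_{(a, c) ∈ r} (∂_a C)(∂_c g)` where
`splittings v = ([], v) :: r`. [cite: Evans2010, App. C.2] -/
theorem cwd_clm_apply_eq {C : EuclideanSpace ℝ ι → (W →L[ℝ] W)} {g : EuclideanSpace ℝ ι → W}
    (hC : ContDiff ℝ ∞ C) (hg : ContDiff ℝ ∞ g) {v : List ι} {r : List (List ι × List ι)}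
    (hr : splittings v = ([], v) :: r) :
    cwd v (fun x ↦ C x (g x)) =
      fun x ↦ C x (cwd v g x) + (r.map fun p ↦ cwd p.1 C x (cwd p.2 g x)).sum := by
  have h := cwd_bilinear (applyCLM W) hC hg v
  simp only [applyCLM_apply] at h
  rw [h]
  funext x
  rw [hr, List.map_cons, List.sum_cons, cwd_nil]

/-! ### The energy inequality for one word -/

/-- **The energy inequality at order `k`, one word.** Let `(Aⱼ, B)` be admissible symmetric
coefficients at order `k` with bound `M` (`IsSymmCoeff`) and `U` an `H^{k+1}`-smooth field. Then
for every word `v` of length `≤ k`,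
`|∫ ⟪∂_v U, ∂_v (𝒫U)⟫| ≤ (n + 1) 2^{k+1} M · ℰ_k(U)`, `𝒫U = Σⱼ Aⱼ ∂ⱼU + B U`,
`ℰ_k(U) = Σ_{|u| ≤ k} ‖∂_u U‖₂²`, `n = |ι|`. Proof: `∂_v (Aⱼ ∂ⱼ U) = Aⱼ ∂ⱼ ∂_v U + Σ' (∂_a Aⱼ)(∂_c ∂ⱼ U)`
with `|c| + 1 ≤ |v|` in `Σ'` (`cwd_bilinear`), `∂_v (B U) = Σ (∂_a B)(∂_c U)`; every remainder term
has `‖·‖₂ ≤ M ℰ_k^{1/2}`, there are at most `(n + 1) 2^k` of them, and the top-order terms are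
bounded by `abs_integral_inner_clm_fderiv_le` (Friedrichs 1954, §2, the energy inequality;
Evans, *PDE*, §7.3.2, Thm. 2). [cite: Friedrichs1954, §2] -/
theorem abs_integral_inner_cwd_foOp_le {k : ℕ} {M : ℝ}
    {A : ι → EuclideanSpace ℝ ι → (W →L[ℝ] W)} {B : EuclideanSpace ℝ ι → (W →L[ℝ] W)}
    (hc : IsSymmCoeff k M A B) {U : EuclideanSpace ℝ ι → W} (hU : IsHkSmooth (k + 1) U)
    {v : List ι} (hv : v.length ≤ k) :
    |∫ x, ⟪cwd v U x, cwd v (foOp A B U) x⟫| ≤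
      (Fintype.card ι + 1) * 2 ^ (k + 1) * M * wordEnergy k U := by
  have hM : 0 ≤ M := hc.nonneg
  set E : ℝ := wordEnergy k U with hE
  set sE : ℝ := Real.sqrt E with hsE
  have hE0 : 0 ≤ E := wordEnergy_nonneg k U
  have hsE0 : 0 ≤ sE := Real.sqrt_nonneg _
  have hsE2 : sE * sE = E := Real.mul_self_sqrt hE0
  -- the field `f = ∂_v U` and its first derivatives
  set f : EuclideanSpace ℝ ι → W := cwd v U with hf
  have hUs : ContDiff ℝ ∞ U := hU.smooth
  have hfs : ContDiff ℝ ∞ f := contDiff_cwd hUs v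
  have hf2 : MemLp f 2 (volume : Measure (EuclideanSpace ℝ ι)) := hU.memLp v (by omega)
  have hfle : l2norm f ≤ sE := l2norm_cwd_le_sqrt_wordEnergy hv U
  have hdjU : ∀ j, ContDiff ℝ ∞ fun y ↦ fderiv ℝ U y (bv j) := fun j ↦
    (hUs.fderiv_right (m := ∞) (by norm_cast)).clm_apply contDiff_const
  have hfj_eq : ∀ j, cwd v (fun y ↦ fderiv ℝ U y (bv j)) = fun x ↦ fderiv ℝ f x (bv j) :=
    fun j ↦ cwd_fderiv_eq_fderiv_cwd hUs v j
  have hfj2 : ∀ j, MemLp (fun x ↦ fderiv ℝ f x (bv j)) 2 (volume : Measure (EuclideanSpace ℝ ι)) := by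
    intro j
    rw [← hfj_eq j, ← cwd_cons_eq_cwd_fderiv hUs j v]
    exact hU.memLp (j :: v) (by simp; omega)
  -- splittings of `v`
  obtain ⟨r, hr, hne⟩ := splittings_eq_cons v
  have hmemr : ∀ p ∈ r, p ∈ splittings v := fun p hp ↦ by rw [hr]; exact List.mem_cons_of_mem _ hp
  have hlenr : ∀ p ∈ r, p.2.length + 1 ≤ v.length ∧ p.1.length ≤ v.length := by
    intro p hp
    have h := length_add_length_of_mem_splittings (hmemr p hp)
    have h1 : 1 ≤ p.1.length := Nat.one_le_iff_ne_zero.mpr (by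
      intro h0; exact hne p hp (List.eq_nil_of_length_eq_zero h0))
    omega
  have hrlen : (r.length : ℝ) ≤ 2 ^ k := by
    have h := length_splittings v
    rw [hr, List.length_cons] at h
    have : r.length ≤ 2 ^ v.length := by omega
    calc (r.length : ℝ) ≤ (2 : ℝ) ^ v.length := by exact_mod_cast this
      _ ≤ 2 ^ k := pow_le_pow_right₀ one_le_two hv
  have hslen : ((splittings v).length : ℝ) ≤ 2 ^ k := by
    rw [length_splittings]
    push_cast
    exact pow_le_pow_right₀ one_le_two hv
  -- the remainder terms of the `Aⱼ`
  set RA : ι → EuclideanSpace ℝ ι → W := fun j x ↦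
    (r.map fun p ↦ cwd p.1 (A j) x (cwd p.2 (fun y ↦ fderiv ℝ U y (bv j)) x)).sum with hRA
  have hRA_bound : ∀ j, MemLp (RA j) 2 (volume : Measure (EuclideanSpace ℝ ι)) ∧
      l2norm (RA j) ≤ r.length * (M * sE) := by
    intro j
    refine memLp_list_sum_and_l2norm_le r (g := fun p x ↦
      cwd p.1 (A j) x (cwd p.2 (fun y ↦ fderiv ℝ U y (bv j)) x)) (fun p hp ↦ ?_) (fun p hp ↦ ?_)
    · obtain ⟨h2, h1⟩ := hlenr p hp
      have hg2 : MemLp (cwd p.2 (fun y ↦ fderiv ℝ U y (bv j))) 2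
          (volume : Measure (EuclideanSpace ℝ ι)) := by
        rw [← cwd_append_singleton]
        exact hU.memLp _ (by simp; omega)
      exact (memLp_clm_apply_and_l2norm_le (continuous_cwd (hc.smoothA j) p.1)
        (continuous_cwd (hdjU j) p.2) hg2 hM (hc.boundA j p.1 (by omega))).1
    · obtain ⟨h2, h1⟩ := hlenr p hp
      have hg2 : MemLp (cwd p.2 (fun y ↦ fderiv ℝ U y (bv j))) 2
          (volume : Measure (EuclideanSpace ℝ ι)) := by
        rw [← cwd_append_singleton]
        exact hU.memLp _ (by simp; omega)
      have hle := (memLp_clm_apply_and_l2norm_le (continuous_cwd (hc.smoothA j) p.1)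
        (continuous_cwd (hdjU j) p.2) hg2 hM (hc.boundA j p.1 (by omega))).2
      refine hle.trans (mul_le_mul_of_nonneg_left ?_ hM)
      rw [← cwd_append_singleton]
      exact l2norm_cwd_le_sqrt_wordEnergy (by simp; omega) U
  -- the terms of `B`
  set RB : EuclideanSpace ℝ ι → W := fun x ↦
    ((splittings v).map fun p ↦ cwd p.1 B x (cwd p.2 U x)).sum with hRB
  have hRB_bound : MemLp RB 2 (volume : Measure (EuclideanSpace ℝ ι)) ∧
      l2norm RB ≤ (splittings v).length * (M * sE) := by
    refine memLp_list_sum_and_l2norm_le (splittings v) (g := fun p x ↦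
      cwd p.1 B x (cwd p.2 U x)) (fun p hp ↦ ?_) (fun p hp ↦ ?_)
    · have h := length_add_length_of_mem_splittings hp
      exact (memLp_clm_apply_and_l2norm_le (continuous_cwd hc.smoothB p.1)
        (continuous_cwd hUs p.2) (hU.memLp p.2 (by omega)) hM (hc.boundB p.1 (by omega))).1
    · have h := length_add_length_of_mem_splittings hp
      have hle := (memLp_clm_apply_and_l2norm_le (continuous_cwd hc.smoothB p.1)
        (continuous_cwd hUs p.2) (hU.memLp p.2 (by omega)) hM (hc.boundB p.1 (by omega))).2
      exact hle.trans (mul_le_mul_of_nonneg_left (l2norm_cwd_le_sqrt_wordEnergy (by omega) U) hM)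
  -- the full remainder
  set R : EuclideanSpace ℝ ι → W := fun x ↦ (∑ j, RA j x) + RB x with hR
  have hRA_sum : MemLp (fun x ↦ ∑ j, RA j x) 2 (volume : Measure (EuclideanSpace ℝ ι)) ∧
      l2norm (fun x ↦ ∑ j, RA j x) ≤ (Finset.univ : Finset ι).card * (2 ^ k * (M * sE)) := by
    refine memLp_finset_sum_and_l2norm_le Finset.univ (fun j _ ↦ (hRA_bound j).1) (fun j _ ↦ ?_)
    refine (hRA_bound j).2.trans ?_
    exact mul_le_mul_of_nonneg_right hrlen (mul_nonneg hM hsE0)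
  have hR2 : MemLp R 2 (volume : Measure (EuclideanSpace ℝ ι)) := hRA_sum.1.add hRB_bound.1
  have hRle : l2norm R ≤ (Fintype.card ι + 1) * 2 ^ k * (M * sE) := by
    have h1 := hRA_sum.2
    rw [Finset.card_univ] at h1
    have h2 : l2norm RB ≤ 2 ^ k * (M * sE) :=
      hRB_bound.2.trans (mul_le_mul_of_nonneg_right hslen (mul_nonneg hM hsE0))
    calc l2norm R ≤ l2norm (fun x ↦ ∑ j, RA j x) + l2norm RB := l2norm_add_le hRA_sum.1 hRB_bound.1
      _ ≤ (Fintype.card ι) * (2 ^ k * (M * sE)) + 2 ^ k * (M * sE) := add_le_add h1 h2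
      _ = (Fintype.card ι + 1) * 2 ^ k * (M * sE) := by ring
  -- the principal part
  set P : EuclideanSpace ℝ ι → W := fun x ↦ ∑ j, A j x (fderiv ℝ f x (bv j)) with hP
  have hPj : ∀ j, MemLp (fun x ↦ A j x (fderiv ℝ f x (bv j))) 2
      (volume : Measure (EuclideanSpace ℝ ι)) := fun j ↦
    (memLp_clm_apply_and_l2norm_le (hc.smoothA j).continuous
      ((hfs.continuous_fderiv (by simp)).clm_apply continuous_const) (hfj2 j) hM
      (fun x ↦ by simpa using hc.boundA j [] (by simp) x)).1
  have hP2 : MemLp P 2 (volume : Measure (EuclideanSpace ℝ ι)) :=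
    memLp_finsetSum Finset.univ fun j _ ↦ hPj j
  -- the decomposition `∂_v (𝒫U) = P + R`
  have hdec : cwd v (foOp A B U) = fun x ↦ P x + R x := by
    have hsmA : ∀ j ∈ (Finset.univ : Finset ι),
        ContDiff ℝ ∞ fun x ↦ A j x (fderiv ℝ U x (bv j)) := fun j _ ↦
      (hc.smoothA j).clm_apply (hdjU j)
    have hsmS : ContDiff ℝ ∞ fun x ↦ ∑ j, A j x (fderiv ℝ U x (bv j)) :=
      ContDiff.sum fun j _ ↦ hsmA j (Finset.mem_univ j)
    have hsmB : ContDiff ℝ ∞ fun x ↦ B x (U x) := hc.smoothB.clm_apply hUs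
    have h0 : foOp A B U = fun x ↦ (∑ j, A j x (fderiv ℝ U x (bv j))) + B x (U x) := rfl
    rw [h0, cwd_fun_add hsmS hsmB, cwd_finset_sum Finset.univ hsmA]
    have hAj : ∀ j, cwd v (fun x ↦ A j x (fderiv ℝ U x (bv j))) =
        fun x ↦ A j x (fderiv ℝ f x (bv j)) + RA j x := by
      intro j
      rw [cwd_clm_apply_eq (hc.smoothA j) (hdjU j) hr, hfj_eq j]
    have hBU : cwd v (fun x ↦ B x (U x)) = RB := by
      have h := cwd_bilinear (applyCLM W) hc.smoothB hUs v
      simp only [applyCLM_apply] at h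
      rw [h]
    funext x
    simp only [hAj, hBU, Finset.sum_add_distrib, hR, hP]
    abel
  -- integrability of the pairings and the split of the integral
  have hPint : ∀ j, Integrable (fun x ↦ ⟪f x, A j x (fderiv ℝ f x (bv j))⟫)
      (volume : Measure (EuclideanSpace ℝ ι)) := fun j ↦ integrable_inner_of_memLp hf2 (hPj j)
  have hfP : (∫ x, ⟪f x, P x⟫) = ∑ j, ∫ x, ⟪f x, A j x (fderiv ℝ f x (bv j))⟫ := by
    rw [← integral_finsetSum Finset.univ fun j _ ↦ hPint j]
    refine integral_congr_ae (Eventually.of_forall fun x ↦ ?_)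
    simp only [hP, inner_sum]
  have hsplit : (∫ x, ⟪cwd v U x, cwd v (foOp A B U) x⟫) =
      (∫ x, ⟪f x, P x⟫) + ∫ x, ⟪f x, R x⟫ := by
    rw [hdec]
    simp only [← hf, inner_add_right]
    exact integral_add (integrable_inner_of_memLp hf2 hP2) (integrable_inner_of_memLp hf2 hR2)
  -- the bounds
  have hPbd : |∫ x, ⟪f x, P x⟫| ≤ Fintype.card ι * (M / 2 * E) := by
    rw [hfP]
    calc |∑ j, ∫ x, ⟪f x, A j x (fderiv ℝ f x (bv j))⟫|
        ≤ ∑ j, |∫ x, ⟪f x, A j x (fderiv ℝ f x (bv j))⟫| := Finset.abs_sum_le_sum_abs _ _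
      _ ≤ ∑ _j : ι, M / 2 * E := Finset.sum_le_sum fun j _ ↦ by
          have h := abs_integral_inner_clm_fderiv_le ((hc.smoothA j).of_le (by norm_cast))
            (hc.symm j) (fun x ↦ by simpa using hc.boundA j [] (by simp) x) j
            (fun x ↦ by simpa [cwd_singleton] using hc.boundA j [j] (by simp) x)
            (hfs.of_le (by norm_cast)) hf2 (hfj2 j)
          refine h.trans (mul_le_mul_of_nonneg_left ?_ (by positivity))
          calc l2norm f ^ 2 ≤ sE ^ 2 := pow_le_pow_left₀ (l2norm_nonneg _) hfle 2
            _ = E := by rw [sq, hsE2]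
      _ = Fintype.card ι * (M / 2 * E) := by simp [Finset.sum_const, Finset.card_univ]
  have hRbd : |∫ x, ⟪f x, R x⟫| ≤ (Fintype.card ι + 1) * 2 ^ k * M * E := by
    calc |∫ x, ⟪f x, R x⟫| ≤ l2norm f * l2norm R := abs_integral_inner_le_l2norm hf2 hR2
      _ ≤ sE * ((Fintype.card ι + 1) * 2 ^ k * (M * sE)) :=
          mul_le_mul hfle hRle (l2norm_nonneg _) hsE0
      _ = (Fintype.card ι + 1) * 2 ^ k * M * E := by rw [← hsE2]; ring
  rw [hsplit]
  have hcard : (0 : ℝ) ≤ Fintype.card ι := Nat.cast_nonneg _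
  have h2k : (1 : ℝ) ≤ 2 ^ k := one_le_pow₀ one_le_two
  calc |(∫ x, ⟪f x, P x⟫) + ∫ x, ⟪f x, R x⟫|
      ≤ |∫ x, ⟪f x, P x⟫| + |∫ x, ⟪f x, R x⟫| := abs_add_le _ _
    _ ≤ Fintype.card ι * (M / 2 * E) + (Fintype.card ι + 1) * 2 ^ k * M * E := add_le_add hPbd hRbd
    _ ≤ (Fintype.card ι + 1) * 2 ^ (k + 1) * M * E := by
        rw [pow_succ]
        nlinarith [mul_nonneg hM hE0, mul_nonneg (mul_nonneg hcard hM) hE0,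
          mul_nonneg (mul_nonneg (sub_nonneg.2 h2k) hM) hE0]

/-! ### `L²` bounds for the word derivatives of `𝒫U` -/

/-- **The word derivatives of `𝒫U` are square integrable, with a Leibniz bound**: for admissible
symmetric coefficients at order `k` with bound `M` and an `H^{k+1}`-smooth `U`, every word `v` of
length `≤ k` has `∂_v (𝒫U) ∈ L²` with `‖∂_v (𝒫U)‖₂ ≤ (n + 1) 2ᵏ M · ℰ_{k+1}(U)^{1/2}` (all terms of the
Leibniz expansion carry at most `k + 1` derivatives on `U`; Evans, *PDE*, §5.2.3, Thm. 1 (iv)).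
[cite: Friedrichs1954, §2] -/
theorem memLp_cwd_foOp_and_l2norm_le {k : ℕ} {M : ℝ}
    {A : ι → EuclideanSpace ℝ ι → (W →L[ℝ] W)} {B : EuclideanSpace ℝ ι → (W →L[ℝ] W)}
    (hc : IsSymmCoeff k M A B) {U : EuclideanSpace ℝ ι → W} (hU : IsHkSmooth (k + 1) U)
    {v : List ι} (hv : v.length ≤ k) :
    MemLp (cwd v (foOp A B U)) 2 (volume : Measure (EuclideanSpace ℝ ι)) ∧
      l2norm (cwd v (foOp A B U)) ≤
        (Fintype.card ι + 1) * 2 ^ k * M * Real.sqrt (wordEnergy (k + 1) U) := by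
  have hM : 0 ≤ M := hc.nonneg
  set E : ℝ := wordEnergy (k + 1) U with hE
  set sE : ℝ := Real.sqrt E with hsE
  have hsE0 : 0 ≤ sE := Real.sqrt_nonneg _
  have hUs : ContDiff ℝ ∞ U := hU.smooth
  have hdjU : ∀ j, ContDiff ℝ ∞ fun y ↦ fderiv ℝ U y (bv j) := fun j ↦
    (hUs.fderiv_right (m := ∞) (by norm_cast)).clm_apply contDiff_const
  -- every term `(∂_a C)(∂_c g)` with `|c| ≤ k + 1` derivatives on `U` has norm `≤ M sE`
  have hterm : ∀ {C : EuclideanSpace ℝ ι → (W →L[ℝ] W)} {u : List ι}, Continuous C →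
      (∀ x, ‖C x‖ ≤ M) → u.length ≤ k + 1 →
      MemLp (fun x ↦ C x (cwd u U x)) 2 (volume : Measure (EuclideanSpace ℝ ι)) ∧
        l2norm (fun x ↦ C x (cwd u U x)) ≤ M * sE := by
    intro C u hC hCM hu
    obtain ⟨hm, hle⟩ := memLp_clm_apply_and_l2norm_le hC (continuous_cwd hUs u) (hU.memLp u hu) hM hCM
    exact ⟨hm, hle.trans (mul_le_mul_of_nonneg_left (l2norm_cwd_le_sqrt_wordEnergy hu U) hM)⟩
  -- the `Aⱼ` terms: full Leibniz expansion, `∂_c ∂ⱼ U = ∂_{c ++ [j]} U`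
  have hAj : ∀ j, MemLp (cwd v fun x ↦ A j x (fderiv ℝ U x (bv j))) 2
      (volume : Measure (EuclideanSpace ℝ ι)) ∧
      l2norm (cwd v fun x ↦ A j x (fderiv ℝ U x (bv j))) ≤ (splittings v).length * (M * sE) := by
    intro j
    have h := cwd_bilinear (applyCLM W) (hc.smoothA j) (hdjU j) v
    simp only [applyCLM_apply] at h
    rw [h]
    refine memLp_list_sum_and_l2norm_le (splittings v)
      (g := fun p x ↦ cwd p.1 (A j) x (cwd p.2 (fun y ↦ fderiv ℝ U y (bv j)) x))
      (fun p hp ↦ ?_) (fun p hp ↦ ?_)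
    · have hl := length_add_length_of_mem_splittings hp
      rw [← cwd_append_singleton]
      exact (hterm (continuous_cwd (hc.smoothA j) p.1) (hc.boundA j p.1 (by omega))
        (by simp; omega)).1
    · have hl := length_add_length_of_mem_splittings hp
      rw [← cwd_append_singleton]
      exact (hterm (continuous_cwd (hc.smoothA j) p.1) (hc.boundA j p.1 (by omega))
        (by simp; omega)).2
  -- the `B` term
  have hBU : MemLp (cwd v fun x ↦ B x (U x)) 2 (volume : Measure (EuclideanSpace ℝ ι)) ∧
      l2norm (cwd v fun x ↦ B x (U x)) ≤ (splittings v).length * (M * sE) := by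
    have h := cwd_bilinear (applyCLM W) hc.smoothB hUs v
    simp only [applyCLM_apply] at h
    rw [h]
    refine memLp_list_sum_and_l2norm_le (splittings v)
      (g := fun p x ↦ cwd p.1 B x (cwd p.2 U x)) (fun p hp ↦ ?_) (fun p hp ↦ ?_)
    · have hl := length_add_length_of_mem_splittings hp
      exact (hterm (continuous_cwd hc.smoothB p.1) (hc.boundB p.1 (by omega)) (by omega)).1
    · have hl := length_add_length_of_mem_splittings hp
      exact (hterm (continuous_cwd hc.smoothB p.1) (hc.boundB p.1 (by omega)) (by omega)).2
  -- assemble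
  have hslen : ((splittings v).length : ℝ) ≤ 2 ^ k := by
    rw [length_splittings]; push_cast; exact pow_le_pow_right₀ one_le_two hv
  have hsmA : ∀ j ∈ (Finset.univ : Finset ι),
      ContDiff ℝ ∞ fun x ↦ A j x (fderiv ℝ U x (bv j)) := fun j _ ↦ (hc.smoothA j).clm_apply (hdjU j)
  have hsmS : ContDiff ℝ ∞ fun x ↦ ∑ j, A j x (fderiv ℝ U x (bv j)) :=
    ContDiff.sum fun j _ ↦ hsmA j (Finset.mem_univ j)
  have hsmB : ContDiff ℝ ∞ fun x ↦ B x (U x) := hc.smoothB.clm_apply hUs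
  have h0 : foOp A B U = fun x ↦ (∑ j, A j x (fderiv ℝ U x (bv j))) + B x (U x) := rfl
  rw [h0, cwd_fun_add hsmS hsmB, cwd_finset_sum Finset.univ hsmA]
  obtain ⟨hSm, hSle⟩ := memLp_finset_sum_and_l2norm_le (Finset.univ : Finset ι)
    (g := fun j ↦ cwd v fun x ↦ A j x (fderiv ℝ U x (bv j))) (fun j _ ↦ (hAj j).1)
    (fun j _ ↦ (hAj j).2)
  have heq : (fun x ↦ (∑ j, cwd v (fun x ↦ A j x (fderiv ℝ U x (bv j))) x) + cwd v (fun x ↦ B x (U x)) x) =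
      (fun x ↦ ∑ j, cwd v (fun x ↦ A j x (fderiv ℝ U x (bv j))) x) + cwd v (fun x ↦ B x (U x)) := by
    funext x; rfl
  rw [heq]
  refine ⟨hSm.add hBU.1, (l2norm_add_le hSm hBU.1).trans ?_⟩
  rw [Finset.card_univ] at hSle
  have hcard : (0 : ℝ) ≤ Fintype.card ι := Nat.cast_nonneg _
  calc l2norm (fun x ↦ ∑ j, cwd v (fun x ↦ A j x (fderiv ℝ U x (bv j))) x) +
        l2norm (cwd v fun x ↦ B x (U x))
      ≤ Fintype.card ι * ((splittings v).length * (M * sE)) + (splittings v).length * (M * sE) :=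
        add_le_add hSle hBU.2
    _ = (Fintype.card ι + 1) * (splittings v).length * (M * sE) := by ring
    _ ≤ (Fintype.card ι + 1) * 2 ^ k * (M * sE) := by
        gcongr
    _ = (Fintype.card ι + 1) * 2 ^ k * M * sE := by ring

/-! ### The energy inequality, summed over the words of length `≤ k` -/

/-- **The energy inequality at order `k`** (Friedrichs 1954, §2; Evans, *PDE*, §7.3.2, Thm. 2):
for admissible symmetric coefficients at order `k` with bound `M` and an `H^{k+1}`-smooth `U`,
`|Σ_{|v| ≤ k} ∫ ⟪∂_v U, ∂_v (𝒫U)⟫| ≤ N_k (n + 1) 2^{k+1} M · ℰ_k(U)`, `N_k = #wordsLE ι k`. For a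
solution of `∂ₜU = 𝒫U` the left side is `½ d/dt ℰ_k(U)`. [cite: Friedrichs1954, §2] -/
theorem abs_sum_integral_inner_cwd_foOp_le {k : ℕ} {M : ℝ}
    {A : ι → EuclideanSpace ℝ ι → (W →L[ℝ] W)} {B : EuclideanSpace ℝ ι → (W →L[ℝ] W)}
    (hc : IsSymmCoeff k M A B) {U : EuclideanSpace ℝ ι → W} (hU : IsHkSmooth (k + 1) U) :
    |∑ v ∈ wordsLE ι k, ∫ x, ⟪cwd v U x, cwd v (foOp A B U) x⟫| ≤
      (wordsLE ι k).card * ((Fintype.card ι + 1) * 2 ^ (k + 1) * M) * wordEnergy k U := by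
  calc |∑ v ∈ wordsLE ι k, ∫ x, ⟪cwd v U x, cwd v (foOp A B U) x⟫|
      ≤ ∑ v ∈ wordsLE ι k, |∫ x, ⟪cwd v U x, cwd v (foOp A B U) x⟫| :=
        Finset.abs_sum_le_sum_abs _ _
    _ ≤ ∑ _v ∈ wordsLE ι k, (Fintype.card ι + 1) * 2 ^ (k + 1) * M * wordEnergy k U :=
        Finset.sum_le_sum fun v hv ↦ abs_integral_inner_cwd_foOp_le hc hU (mem_wordsLE.1 hv)
    _ = (wordsLE ι k).card * ((Fintype.card ι + 1) * 2 ^ (k + 1) * M) * wordEnergy k U := by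
        rw [Finset.sum_const, nsmul_eq_mul]; ring

/-- **The pairing with a source**: for an `H^k`-smooth `U` and any field `F` whose word
derivatives of length `≤ k` are in `L²` with `‖∂_v F‖₂ ≤ b`,
`|Σ_{|v| ≤ k} ∫ ⟪∂_v U, ∂_v F⟫| ≤ N_k · b · ℰ_k(U)^{1/2}` (Cauchy–Schwarz termwise) — the form in
which inhomogeneities and regularisation errors enter the energy inequality.
[cite: Friedrichs1954, §2] -/
theorem abs_sum_integral_inner_cwd_le {k : ℕ} {U F : EuclideanSpace ℝ ι → W} (hU : IsHkSmooth k U)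
    (hF : ∀ v : List ι, v.length ≤ k → MemLp (cwd v F) 2 (volume : Measure (EuclideanSpace ℝ ι)))
    {b : ℝ} (hb : ∀ v : List ι, v.length ≤ k → l2norm (cwd v F) ≤ b) :
    |∑ v ∈ wordsLE ι k, ∫ x, ⟪cwd v U x, cwd v F x⟫| ≤
      (wordsLE ι k).card * b * Real.sqrt (wordEnergy k U) := by
  have hb0 : 0 ≤ b := (l2norm_nonneg _).trans (hb [] (by simp))
  calc |∑ v ∈ wordsLE ι k, ∫ x, ⟪cwd v U x, cwd v F x⟫|
      ≤ ∑ v ∈ wordsLE ι k, |∫ x, ⟪cwd v U x, cwd v F x⟫| := Finset.abs_sum_le_sum_abs _ _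
    _ ≤ ∑ _v ∈ wordsLE ι k, b * Real.sqrt (wordEnergy k U) :=
        Finset.sum_le_sum fun v hv ↦ by
          have hvk := mem_wordsLE.1 hv
          calc |∫ x, ⟪cwd v U x, cwd v F x⟫| ≤ l2norm (cwd v U) * l2norm (cwd v F) :=
                abs_integral_inner_le_l2norm (hU.memLp v hvk) (hF v hvk)
            _ ≤ Real.sqrt (wordEnergy k U) * b := mul_le_mul (l2norm_cwd_le_sqrt_wordEnergy hvk U)
                (hb v hvk) (l2norm_nonneg _) (Real.sqrt_nonneg _)
            _ = b * Real.sqrt (wordEnergy k U) := mul_comm _ _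
    _ = (wordsLE ι k).card * b * Real.sqrt (wordEnergy k U) := by
        rw [Finset.sum_const, nsmul_eq_mul]; ring

end Estimates

end Literature.Analysis.PDE

end
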